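import Mathlib
import HarnessLib
import Summits.HubbardSuperconductivity.HubbardSuperconductivity.Theorems.KLProgrammeKLRegimeTwoVolumeSourceProfileKitF
import Summits.HubbardSuperconductivity.HubbardSuperconductivity.Theorems.KLProgrammeKLRegimeTwoVolumeSourceReadout

/-!
# Route `KLProgramme` — crux K3, VL child `KLRegimeVolumeLimitV17F3` (stmt-HubbardSuperconductivity-23356), cure of LR13′ «(VL)-HUV-CURRENCY-PROPAGATION»,
# consumer step C3a: THE WEIGHTED ROWS OF THE `F`-ANALYSED TWO-LEG KERNEL ARE A SUB-SUM OF TOKEN #24-F (seat hubbard-kl-k3c4-p1 g20; `--supports` 23356)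

The END door `…V12EndDoorsWB.framedNestedFlowTextV17F2_of_windowGluedPosDefect_weightedRows_wf2` asks the `ε`-weighted, `(1 + Λ‖y‖_𝕋)`-weighted rows of the
WINDOWED two-leg kernel `sectorisedKernel … (srcWindowFamily L M) 𝒱⁽ⁿ⁾[K] 2 ((0,↑,+),(0,↑,−))`.  With PLAIN token #24 they were reached through the smoothing
(`…SourceWindowedWeightedRows.exists_windowedWeightedRows_le`, constant `C_W²`); with token #24 in the currency `F = srcWindowFamily`
(`…TwoVolumeSourceProfileDefsF.SourceProfilesAtLevF`) they ARE a sub-sum of the degree-`2`, two-source pinned sum — the `F`-twin of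
`…TwoVolumeSourceReadout.weightedRows_le_klSrcPinnedSum`, at any label family `F_J`, rate `r` and action `𝒱⁽ⁿ⁾`:
* `kernel_klSrcActionAtF_pair` — the `(+,−)` slot-`0` source pair reads `sectorisedKernel … F 𝒱⁽ⁿ⁾ 2 ((0,0,+),(0,0,−))`;
* `one_add_klScale_mul_tnorm_le_klScaleWt_pairAt` — `1 + Λ_r‖y‖_𝕋 ≤` the rate-`r` tree weight of the pair (labels of any sector count);
* **`weightedRows_le_klSrcPinnedSumAtF`** — `ε·Σ_{t₁,y}(1 + Λ_r‖y‖_𝕋)·‖W^F(o,(t₁,o⃗+y))‖ ≤ klSrcPinnedSumAtF … F J r n 2 2 0 ((o,(0,↑,+)),1)`;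
* `SourceProfilesAtLevF.of_rate_le` — a larger rate index is still met; **`windowedRowsF_le_of_sourceProfilesAtLevF`** — under
  `SourceProfilesAtLevF L M (klSrcBudget P Q U A j) … F J r n` the weighted rows are `≤ A j 2`.
Proofs only; no definition; nothing asserts any VL stub, K3 or superconductivity.
References: BGM 2006 §2.9 (4.3)–(4.8) [cite: BenfattoGiulianiMastropietro2006].
-/

noncomputable section

namespace Summit.HubbardSuperconductivity.HubbardSuperconductivity.Theorems.TwoVolumeSource

set_option linter.dupNamespace false -- summit = problem name (single-conjunct summit), D-0017

open Finset Literature.MathematicalPhysics.QuantumLattice Literature.Probability.LatticeModels GrassmannAlgebra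
open Summit.HubbardSuperconductivity.HubbardSuperconductivity.Theorems.KLProgrammeLegKernels
open Summit.HubbardSuperconductivity.HubbardSuperconductivity.Theorems.KLRegimeSplit
open Summit.HubbardSuperconductivity.HubbardSuperconductivity.Theorems.TwoVolumeDefect
open Summit.HubbardSuperconductivity.HubbardSuperconductivity.Theorems.EngineV8

variable {L M : ℕ} [NeZero L]

/-- The `(+,−)` source pair at `(x, y)`, spin `↑`, sector slot `0`, of the `F`-analysed action is the `F`-sectorised two-leg kernel of `𝒱⁽ⁿ⁾` — for every `J`.
[cite: BenfattoGiulianiMastropietro2006, §2.9 (4.3)-(4.6)] -/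
theorem kernel_klSrcActionAtF_pair (β U μ : ℝ) (K : TrigPolyC4v) (F : Fin 1 → FreqMomentum L M → ℂ) (J n : ℕ) (x y : SpaceTimeIdx L M) :
    kernel ℂ (klSrcActionAtF L M β U μ K F J n) 2
        ![((x, ((⟨0, sectorCount_pos J⟩, 0), 0)), 1), ((y, ((⟨0, sectorCount_pos J⟩, 0), 1)), 1)] =
      sectorisedKernel L M β F (klEffectiveAction L M β U μ K klE0 n) 2 (![((0, 0), 0), ((0, 0), 1)] : Fin 2 → SectorLeg 1) ![x, y] := by
  rw [kernel_klSrcActionAtF_src β U μ K F J n 2 _ (fun i => by fin_cases i <;> rfl) (fun i => by fin_cases i <;> rfl)]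
  congr 1 <;> funext i <;> fin_cases i <;> rfl

/-- The rate-`r` tree weight of a source pair (labels of sector count `J`) dominates `1 + Λ_r‖y‖_𝕋` (`0 ≤ β`). [folklore] -/
theorem one_add_klScale_mul_tnorm_le_klScaleWt_pairAt {β : ℝ} (hβ : 0 ≤ β) (J r : ℕ) (of : SpaceTimeIdx L M) (t₁ : ImagTimeIdx M)
    (y : TorusSite 2 L) :
    1 + klScale klE0 r * (Torus.tnorm y : ℝ) ≤
      klScaleWt L M β r ((univ.image (![((of, ((⟨0, sectorCount_pos J⟩, 0), 0)), 1), (((t₁, of.2 + y), ((⟨0, sectorCount_pos J⟩, 0), 1)), 1)] :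
          Fin 2 → SrcLabel L M J)).image (srcLegPos L M (2 * (2 * M)))) := by
  classical
  set X : Fin 2 → SrcLabel L M J :=
    ![((of, ((⟨0, sectorCount_pos J⟩, 0), 0)), 1), (((t₁, of.2 + y), ((⟨0, sectorCount_pos J⟩, 0), 1)), 1)] with hX
  rw [klScaleWt_apply]
  have hΛ : 0 ≤ klScale klE0 r := (klth_klScale_pos r).le
  refine add_le_add le_rfl (mul_le_mul_of_nonneg_left ?_ hΛ)
  have ha : srcLegPos L M (2 * (2 * M)) (X 0) ∈ (univ.image X).image (srcLegPos L M (2 * (2 * M))) :=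
    mem_image_of_mem _ (mem_image_of_mem _ (mem_univ 0))
  have hb : srcLegPos L M (2 * (2 * M)) (X 1) ∈ (univ.image X).image (srcLegPos L M (2 * (2 * M))) :=
    mem_image_of_mem _ (mem_image_of_mem _ (mem_univ 1))
  refine le_trans ?_ (BattleFederbush.le_labelDiam _ ha hb)
  rw [gridLabelDist_apply]
  have hc : 0 ≤ β / (2 * (2 * M) : ℕ) * cyclicDist (2 * (2 * M)) (srcLegPos L M (2 * (2 * M)) (X 0)).1 (srcLegPos L M (2 * (2 * M)) (X 1)).1 :=
    mul_nonneg (by positivity) (Nat.cast_nonneg _)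
  have hd : (Torus.tnorm y : ℝ) = torusSiteDist (srcLegPos L M (2 * (2 * M)) (X 0)).2 (srcLegPos L M (2 * (2 * M)) (X 1)).2 := by
    have h2 : (srcLegPos L M (2 * (2 * M)) (X 0)).2 = of.2 := rfl
    have h3 : (srcLegPos L M (2 * (2 * M)) (X 1)).2 = of.2 + y := rfl
    rw [h2, h3, ← tnorm_sub_eq_torusSiteDist, sub_add_cancel_left,
      le_antisymm (Torus.tnorm_neg_le y) (by simpa using Torus.tnorm_neg_le (-y))]
  linarith

/-- **THE WEIGHTED DICTIONARY AT A GENERIC SOURCE FAMILY**: the `ε`-weighted, `(1 + Λ_r‖y‖_𝕋)`-weighted rows of the `F`-sectorised two-leg kernel of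
`𝒱⁽ⁿ⁾[K]` at the pin `o` are a sub-sum of `klSrcPinnedSumAtF … F J r n 2 2 0 ((o,(0,↑,+)),1)` (`0 ≤ β`). [cite: BenfattoGiulianiMastropietro2006, §2.9 (4.3)-(4.6)] -/
theorem weightedRows_le_klSrcPinnedSumAtF {β : ℝ} (hβ : 0 ≤ β) (U μ : ℝ) (K : TrigPolyC4v) (F : Fin 1 → FreqMomentum L M → ℂ) (J r n : ℕ)
    (of : SpaceTimeIdx L M) :
    imagTimeWeight β M * ∑ t₁ : ImagTimeIdx M, ∑ y : TorusSite 2 L,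
        (1 + klScale klE0 r * (Torus.tnorm y : ℝ)) *
          ‖sectorisedKernel L M β F (klEffectiveAction L M β U μ K klE0 n) 2
              (![((0, 0), 0), ((0, 0), 1)] : Fin 2 → SectorLeg 1) ![of, (t₁, of.2 + y)]‖ ≤
      klSrcPinnedSumAtF L M β U μ K F J r n 2 2 0 ((of, ((⟨0, sectorCount_pos J⟩, 0), 0)), 1) := by
  classical
  have hε : 0 ≤ imagTimeWeight β M := imagTimeWeight_nonneg hβ M
  have h21 : imagTimeWeight β M ^ (2 - 1) = imagTimeWeight β M := by norm_num
  rw [klSrcPinnedSumAtF_def, h21]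
  refine mul_le_mul_of_nonneg_left ?_ hε
  let φ : ImagTimeIdx M × TorusSite 2 L → (Fin 2 → SrcLabel L M J) := fun p =>
    ![((of, ((⟨0, sectorCount_pos J⟩, 0), 0)), 1), (((p.1, of.2 + p.2), ((⟨0, sectorCount_pos J⟩, 0), 1)), 1)]
  let g : (Fin 2 → SrcLabel L M J) → ℝ := fun X =>
    klScaleWt L M β r ((univ.image X).image (srcLegPos L M (2 * (2 * M)))) * ‖kernel ℂ (klSrcActionAtF L M β U μ K F J n) 2 X‖
  have hφ1 : ∀ p : ImagTimeIdx M × TorusSite 2 L, ((φ p) 1).1.1 = (p.1, of.2 + p.2) := fun p => rfl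
  have hφ0 : ∀ p : ImagTimeIdx M × TorusSite 2 L, (φ p) 0 = ((of, ((⟨0, sectorCount_pos J⟩, 0), 0)), 1) := fun p => rfl
  have hφinj : Function.Injective φ := by
    intro p q h
    have h1 : (p.1, of.2 + p.2) = (q.1, of.2 + q.2) := by rw [← hφ1 p, ← hφ1 q, h]
    obtain ⟨h2, h3⟩ := Prod.mk.inj h1
    exact Prod.ext h2 (add_left_cancel h3)
  have hterm : ∀ (t₁ : ImagTimeIdx M) (y : TorusSite 2 L),
      (1 + klScale klE0 r * (Torus.tnorm y : ℝ)) *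
          ‖sectorisedKernel L M β F (klEffectiveAction L M β U μ K klE0 n) 2
              (![((0, 0), 0), ((0, 0), 1)] : Fin 2 → SectorLeg 1) ![of, (t₁, of.2 + y)]‖ ≤ g (φ (t₁, y)) := by
    intro t₁ y
    show _ ≤ klScaleWt L M β r _ * ‖kernel ℂ (klSrcActionAtF L M β U μ K F J n) 2
      ![((of, ((⟨0, sectorCount_pos J⟩, 0), 0)), 1), (((t₁, of.2 + y), ((⟨0, sectorCount_pos J⟩, 0), 1)), 1)]‖
    rw [kernel_klSrcActionAtF_pair]
    exact mul_le_mul_of_nonneg_right (one_add_klScale_mul_tnorm_le_klScaleWt_pairAt hβ J r of t₁ y) (norm_nonneg _)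
  have hsrc : ∀ p : ImagTimeIdx M × TorusSite 2 L, srcCount (fun Y : SrcLabel L M J => Y.2 = 1) (φ p) = 2 := by
    intro p
    rw [srcCount, filter_true_of_mem fun j _ => by fin_cases j <;> rfl, card_univ, Fintype.card_fin]
  calc ∑ t₁ : ImagTimeIdx M, ∑ y : TorusSite 2 L, (1 + klScale klE0 r * (Torus.tnorm y : ℝ)) *
          ‖sectorisedKernel L M β F (klEffectiveAction L M β U μ K klE0 n) 2
              (![((0, 0), 0), ((0, 0), 1)] : Fin 2 → SectorLeg 1) ![of, (t₁, of.2 + y)]‖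
      ≤ ∑ t₁ : ImagTimeIdx M, ∑ y : TorusSite 2 L, g (φ (t₁, y)) := sum_le_sum fun t₁ _ => sum_le_sum fun y _ => hterm t₁ y
    _ = ∑ p : ImagTimeIdx M × TorusSite 2 L, g (φ p) := (Fintype.sum_prod_type fun p : ImagTimeIdx M × TorusSite 2 L => g (φ p)).symm
    _ = ∑ X ∈ (univ : Finset (ImagTimeIdx M × TorusSite 2 L)).image φ, g X := (sum_image fun p _ q _ h => hφinj h).symm
    _ ≤ ∑ X ∈ univ.filter (fun X : Fin 2 → SrcLabel L M J =>
          X 0 = ((of, ((⟨0, sectorCount_pos J⟩, 0), 0)), 1) ∧ srcCount (fun Y : SrcLabel L M J => Y.2 = 1) X = 2), g X := by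
        refine sum_le_sum_of_subset_of_nonneg ?_ fun X _ _ =>
          mul_nonneg (zero_le_one.trans (one_le_klScaleWt L M β r _)) (norm_nonneg _)
        intro X hX
        obtain ⟨p, -, rfl⟩ := mem_image.1 hX
        exact mem_filter.2 ⟨mem_univ _, hφ0 p, hsrc p⟩

/-- A larger rate index is still met (the tree weight is antitone in the rate). [folklore] -/
theorem SourceProfilesAtLevF.of_rate_le [NeZero M] {S : ℕ → ℕ → ℝ} {β U μ : ℝ} (hβ : 0 ≤ β) {K : TrigPolyC4v} {F : Fin 1 → FreqMomentum L M → ℂ}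
    {J r r' n : ℕ} (h : SourceProfilesAtLevF L M S β U μ K F J r n) (hr : r ≤ r') : SourceProfilesAtLevF L M S β U μ K F J r' n :=
  fun s hs hs2 m q w => (klSrcPinnedSumAtF_anti_rate hβ U μ K F J n s m hr q w).trans (h s hs hs2 m q w)

/-- **Token #24-F pays the END door's weighted rows with constant ONE**: under `SourceProfilesAtLevF L M (klSrcBudget P Q U A j) β U μ K F J r n` the
`ε`-weighted, `(1 + Λ_r‖y‖_𝕋)`-weighted rows of the `F`-sectorised two-leg kernel of `𝒱⁽ⁿ⁾[K]` at every pin are `≤ A j 2`.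
[cite: BenfattoGiulianiMastropietro2006, §2.9 (4.3)-(4.8)] -/
theorem windowedRowsF_le_of_sourceProfilesAtLevF {β : ℝ} (hβ : 0 ≤ β) {U μ : ℝ} {K : TrigPolyC4v} {F : Fin 1 → FreqMomentum L M → ℂ}
    {P : SplitConsts} {Q : EngConsts} {A : ℕ → ℕ → ℝ} {j J r n : ℕ} (h : SourceProfilesAtLevF L M (klSrcBudget P Q U A j) β U μ K F J r n)
    (of : SpaceTimeIdx L M) :
    imagTimeWeight β M * ∑ t₁ : ImagTimeIdx M, ∑ y : TorusSite 2 L,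
        (1 + klScale klE0 r * (Torus.tnorm y : ℝ)) *
          ‖sectorisedKernel L M β F (klEffectiveAction L M β U μ K klE0 n) 2
              (![((0, 0), 0), ((0, 0), 1)] : Fin 2 → SectorLeg 1) ![of, (t₁, of.2 + y)]‖ ≤ A j 2 := by
  have h2 := h.two 2 0 ((of, ((⟨0, sectorCount_pos J⟩, 0), 0)), 1)
  rw [klSrcBudget_of_le_two P Q U A j 2 le_rfl] at h2
  exact (weightedRows_le_klSrcPinnedSumAtF hβ U μ K F J r n of).trans h2

end Summit.HubbardSuperconductivity.HubbardSuperconductivity.Theorems.TwoVolumeSource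

end
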